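/-
Copyright (c) 2026 the pub-hodgecm-mathlib formalisation cell (harness21).  Prover seat hodgecm-mathlib-R90-C10-p05 (g2), R90-TF SLAB section S1 «Ch10-local» (base
R90-C10), h413 = `stmt-HodgeConjecture-24833`; line «B_pos» (U4Keys :182 in BRANCH B at positive depth, all inert places — R-S1-17), brick (B-5) part 2a — «THE `x`-SIDE LEVEL
SETS OF `R = L ⊗ L⁺_v`»: `{|x|² ≤ eᵏ} = {|x| ≤ e^{⌊k∕2⌋}}`, `{|x|² = e^{2t}} = {|x| = eᵗ}`, `{|x|² = e^{2t+1}} = ∅`, Borel-ness of spheres.  2026-09-05.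
-/
import Summits.HodgeConjecture.HodgeConjecture.Theorems.R90S1BposChartAndMasses   -- ★ p863641 (this seat): `isCompact_setOf_valued_le_exp` (the level-`t` balls of `R` are compact)
import HarnessLib

/-!
# R90-TF S1 «Ch10-local» ∕ K2 E3 «U4Keys» :182, BRANCH B AT POSITIVE DEPTH (ALL INERT PLACES) — brick (B-5), part 2a: THE `x`-SIDE LEVEL SETS OF `R`
# «the values of `|·|_w` on `R = L ⊗ L⁺_v` are `0` and `eˡ` (`l ∈ ℤ`): squares-to-levels set identities and Borel-ness of the spheres»  [Rogawski1990 §1.10; WeilBNT1967 Ch. I §4]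

Cell `pub/hodgecm-mathlib`, crux H413 = `stmt-HodgeConjecture-24833`, route of record `HCCMUnconditional` (no route verbs); R90-TF section S1.  THEOREMS ONLY (no `def`, no `instance`,
no `notation`, no named-fact hypothesis, no `sorry`); lane `--supports stmt-HodgeConjecture-24833 --as helper`, count-neutral.  NOT THE PAYER of :182.  FRAME: `R := LocalRing L v`, a
place `w ∣ v` (`v` non-split, unramified in `L`).  THE POINT: the cut-off shell integrals of the Casselman integrand (part 2 `R90S1BposCutoffShellIntegral`) produce the `x`-side level
sets `{x : |x_w|² ≤ e^{j−N}}` and `{x : |x_w|² = e^{j−N+1}}` (the base of the skew-line fibre at `x` has absolute value `|xσx|_w = |x|_w²`); their masses are read from the level-`t` balls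
and spheres of ★ part 1 (`measureReal_setOf_valued_le_exp`, `measureReal_setOf_valued_eq_exp`) through the set identities below (consumers: part 2, (B-5x) `R90S1BposShellParityMasses`).
* `setOf_valued_sq_le_exp_eq`, `setOf_valued_sq_eq_exp_eq_of_even`, `setOf_valued_sq_eq_exp_eq_empty_of_odd`, `measurableSet_setOf_valued_eq_exp`, `measurableSet_setOf_valued_sq_eq_exp`.
HONEST LABEL.  HC_CM is proved only modulo the 7 printed citations (2 remaining named inputs: hLiu418 = `stmt-HodgeConjecture-24832`, h413 = `stmt-HodgeConjecture-24833`) until rung 0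
closes; count-neutral — this file does NOT pay :182 or A2′; no printed citation is discharged.

## References
* [Rogawski1990] J. D. Rogawski, *Automorphic Representations of Unitary Groups in Three Variables*, Ann. of Math. Stud. 123 (1990), §1.10 p. 9.
* [WeilBNT1967] A. Weil, *Basic Number Theory* (1967), Ch. I §4 (the module and the value group of a local field).
-/

set_option autoImplicit false
set_option linter.dupNamespace false  -- the mandated namespace has the single-problem summit's repeated segment (`HodgeConjecture.HodgeConjecture`)

noncomputable section

open NumberField IsDedekindDomain MeasureTheory Measure Literature.NumberTheory Literature.NumberTheory.Automorphic Literature.NumberTheory.Automorphic.UnitaryGroup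
open scoped WithZero Valued

namespace Summit.HodgeConjecture.HodgeConjecture.R90.S1.BposShellLevelSets

open Summit.HodgeConjecture.HodgeConjecture.R90.S1.BposChartAndMasses

variable (L : Type) [Field L] [NumberField L] [IsCMField L] (v : HeightOneSpectrum (𝓞 ↥(maximalRealSubfield L)))
  (w : PlacesOver L v) (hw : IsCMField.complexConj L • w.1 = w.1)

/-! ## The level sets -/

omit [IsCMField L] in
/-- **`{x : |x_w|² ≤ eᵏ} = {x : |x_w| ≤ e^{⌊k∕2⌋}`** (`k ∈ ℤ`, integer division rounding down). [cite: Rogawski1990, §1.10 p. 9] [cite: WeilBNT1967, Ch. I §4] -/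
theorem setOf_valued_sq_le_exp_eq (k : ℤ) :
    {x : LocalRing L v | Valued.v (x w) * Valued.v (x w) ≤ WithZero.exp k} = {x : LocalRing L v | Valued.v (x w) ≤ WithZero.exp (k / 2)} := by
  ext x
  simp only [Set.mem_setOf_eq]
  rcases eq_or_ne (x w) 0 with h0 | h0
  · rw [h0, map_zero, mul_zero]; exact ⟨fun _ => zero_le, fun _ => zero_le⟩
  · obtain ⟨l, hl⟩ : ∃ l : ℤ, Valued.v (x w) = WithZero.exp l := ⟨_, (WithZero.exp_log ((Valuation.ne_zero_iff _).2 h0)).symm⟩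
    rw [hl, ← WithZero.exp_add, WithZero.exp_le_exp, WithZero.exp_le_exp]
    omega

omit [IsCMField L] in
/-- **`{x : |x_w|² = e^{2t}} = {x : |x_w| = eᵗ}`.** [cite: Rogawski1990, §1.10 p. 9] [cite: WeilBNT1967, Ch. I §4] -/
theorem setOf_valued_sq_eq_exp_eq_of_even (k t : ℤ) (hk : k = 2 * t) :
    {x : LocalRing L v | Valued.v (x w) * Valued.v (x w) = WithZero.exp k} = {x : LocalRing L v | Valued.v (x w) = WithZero.exp t} := by
  ext x
  simp only [Set.mem_setOf_eq]
  rcases eq_or_ne (x w) 0 with h0 | h0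
  · rw [h0, map_zero, mul_zero]; exact ⟨fun h => absurd h WithZero.zero_ne_coe, fun h => absurd h WithZero.zero_ne_coe⟩
  · obtain ⟨l, hl⟩ : ∃ l : ℤ, Valued.v (x w) = WithZero.exp l := ⟨_, (WithZero.exp_log ((Valuation.ne_zero_iff _).2 h0)).symm⟩
    rw [hl, ← WithZero.exp_add]
    constructor
    · intro h; have h' := WithZero.exp_injective h; congr 1; omega
    · intro h; have h' := WithZero.exp_injective h; congr 1; omega

omit [IsCMField L] in
/-- **`{x : |x_w|² = e^{2t+1}} = ∅`** (a square is an even power). [cite: Rogawski1990, §1.10 p. 9] [cite: WeilBNT1967, Ch. I §4] -/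
theorem setOf_valued_sq_eq_exp_eq_empty_of_odd (k t : ℤ) (hk : k = 2 * t + 1) :
    {x : LocalRing L v | Valued.v (x w) * Valued.v (x w) = WithZero.exp k} = ∅ := by
  ext x
  simp only [Set.mem_setOf_eq, Set.mem_empty_iff_false, iff_false]
  rcases eq_or_ne (x w) 0 with h0 | h0
  · rw [h0, map_zero, mul_zero]; exact WithZero.zero_ne_coe
  · obtain ⟨l, hl⟩ : ∃ l : ℤ, Valued.v (x w) = WithZero.exp l := ⟨_, (WithZero.exp_log ((Valuation.ne_zero_iff _).2 h0)).symm⟩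
    rw [hl, ← WithZero.exp_add]
    intro h; have h' := WithZero.exp_injective h; omega

include hw in
/-- the sphere `{x : |x_w| = eᵗ}` of `R` is Borel (difference of two compact balls, 📤 `isCompact_setOf_valued_le_exp`). [cite: Rogawski1990, §1.10 p. 9] [cite: WeilBNT1967, Ch. I §4] -/
theorem measurableSet_setOf_valued_eq_exp [MeasurableSpace (LocalRing L v)] [BorelSpace (LocalRing L v)] (hunr : Algebra.IsUnramifiedIn (𝓞 L) v.asIdeal) (t : ℤ) :
    MeasurableSet {x : LocalRing L v | Valued.v (x w) = WithZero.exp t} := by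
  have hset : {x : LocalRing L v | Valued.v (x w) = WithZero.exp t} =
      {x : LocalRing L v | Valued.v (x w) ≤ WithZero.exp t} \ {x : LocalRing L v | Valued.v (x w) ≤ WithZero.exp (t - 1)} := by
    ext x
    simp only [Set.mem_setOf_eq, Set.mem_sdiff, not_le]
    constructor
    · intro h
      exact ⟨h.le, by rw [h]; exact WithZero.exp_lt_exp.2 (by omega)⟩
    · rintro ⟨h1, h2⟩
      rcases eq_or_ne (x w) 0 with h0 | h0
      · rw [h0, map_zero] at h2; exact absurd h2 (not_lt.2 zero_le)
      · obtain ⟨l, hl⟩ : ∃ l : ℤ, Valued.v (x w) = WithZero.exp l := ⟨_, (WithZero.exp_log ((Valuation.ne_zero_iff _).2 h0)).symm⟩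
        rw [hl] at h1 h2 ⊢
        rw [WithZero.exp_le_exp] at h1
        rw [WithZero.exp_lt_exp] at h2
        congr 1; omega
  rw [hset]
  exact (isCompact_setOf_valued_le_exp L v w hw hunr t).isClosed.measurableSet.diff (isCompact_setOf_valued_le_exp L v w hw hunr (t - 1)).isClosed.measurableSet

include hw in
/-- the `x`-side level set `{x : |x_w|² = eᵏ}` is Borel, of finite measure for every additive Haar measure (a sphere or empty). [cite: Rogawski1990, §1.10 p. 9] [cite: WeilBNT1967, Ch. I §4] -/
theorem measurableSet_setOf_valued_sq_eq_exp [MeasurableSpace (LocalRing L v)] [BorelSpace (LocalRing L v)] (hunr : Algebra.IsUnramifiedIn (𝓞 L) v.asIdeal) (k : ℤ) :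
    MeasurableSet {x : LocalRing L v | Valued.v (x w) * Valued.v (x w) = WithZero.exp k} ∧
      {x : LocalRing L v | Valued.v (x w) * Valued.v (x w) = WithZero.exp k} ⊆ {x : LocalRing L v | Valued.v (x w) ≤ WithZero.exp (k / 2)} := by
  refine ⟨?_, fun x (hx : Valued.v (x w) * Valued.v (x w) = WithZero.exp k) => ?_⟩
  · rcases Int.emod_two_eq_zero_or_one k with hk | hk
    · rw [setOf_valued_sq_eq_exp_eq_of_even L v w k (k / 2) (by omega)]
      exact measurableSet_setOf_valued_eq_exp L v w hw hunr (k / 2)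
    · rw [setOf_valued_sq_eq_exp_eq_empty_of_odd L v w k (k / 2) (by omega)]
      exact MeasurableSet.empty
  · have hx' : x ∈ {x : LocalRing L v | Valued.v (x w) * Valued.v (x w) ≤ WithZero.exp k} := le_of_eq hx
    rw [setOf_valued_sq_le_exp_eq L v w k] at hx'
    exact hx'

end Summit.HodgeConjecture.HodgeConjecture.R90.S1.BposShellLevelSets

end
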